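import Summits.CriticalPhenomena.PercolationContinuityZ3.Theorems.PercNearOneGluingNoHeavyQuantSingleGateDominant
import Summits.CriticalPhenomena.PercolationContinuityZ3.Theorems.PercNearOneGluingNoHeavyQuantConvPieceBudget
import HarnessLib

/-!
# QUANT lane R8, T-DEC: THE GATED PER-COMPONENT BUDGET for `SingleGateConvClosed` at the far-dominant layers `4j < q(2T₂ + T₁)`
# (part 1 of 2 of `…QuantSingleGateFarDominant`; light credit pairs allowed)

builds on p205010 (kernel theorem, internal audit signed; external expert review pending)

Support file (`--supports stmt-CriticalPhenomena-4575`), QUANT lane seat prim-quant-arm-2 (gen 34), rung R8 of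
`run/shared/lean/prim/quant/LADDER.md`.  Theorems only (no definitions), standard axioms, no sorries.  Uses this seat's `…QuantSingleGateDominant`
(`gateConv_tail_eq_pieces`, `gateConv_tail_ge_theta`), `…QuantConvPieceBudget` (`piece_budget`, `deepLows_le_giants_pred`), `…QuantDeepLowsGiants`.

WHAT.  `0 < y < 1`, `y ≤ q ≤ 1`; `μ₁`, `μ₂` probability laws on `{0..M₁}`, `{0..M₂}` (means `T₁`, `T₂`) whose gated laws `νᵢ = gate_q μᵢ` are
top-affordable (`y·Mᵢ ≤ q·Tᵢ`) and DEC at every layer below their tops — the hypotheses of `SingleGateConvClosed`, ANY data; a layer `j` with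
`4j < q(2T₂ + T₁)`.  THEN **`y ≤ Σ_{h > j} gate_q(μ₁ ∗ μ₂) h`** (`gateConv_tail_ge_farDominant`); DEC form and the two-sided corollary
**`gateConv_decAt_farDominant`** (`4j < q(2T₂+T₁) ∨ 4j < q(2T₁+T₂)`: three quarters of the dominant range, no heaviness on either factor).
PROOF.  `P{>j} = Σ_r λ_r W_r − (1−q)θ/q` over `ν₂`'s DEC datum at layer `j` (bare tails `Ψ`, `θ = ν₁{>j} ≤ P{>j}`: `…QuantSingleGateDominant`).
Split each component's weight as `up + v + a` (`up` = mass above `j`; `v` = the low of a giant pair when it is DEEP, `lo + j < qT₂`; `a` = the rest)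
and give it a debt `d ≤ a` (the deep mass of a LIGHT credit pair; such a pair has `lo ≥ 1`, a light zero-component being impossible under
top-affordability).  Per piece (`piece_budget` on `ν₁` for the credit pairs, the rows / the two-layer bound of `ν₁` otherwise):
`W_r ≥ y + u_r + v_r·θ/q − (y/q)·d_r` with `u_r = (1−y)up_r − y·v_r + ((1−q)y/q)·a_r`.  Summing: `X + V + A = 1` (`X = ν₂{>j}`),
`V + D ≤ ν₂{deep}`, `D ≤ ν₂{deep, ≥ 1}`; `deepLows_le_giants_pred` for `ν₂` gives `y·ν₂{deep} ≤ (1−y)X`; and if `D > 0` the zero atom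
(mass `≥ 1−q`) is deep and all deep atoms are lows (`≤ 1−y` in total), so `D ≤ q − y`.  The total `y + U + (V − (1−q))θ/q − (y/q)D` is affine in
`θ`: for `V ≥ 1−q` it is `≥ y` because `U ≥ (y/q)D`; for `V < 1−q` and `θ ≤ y` it is `≥ y + X(q−y)/q − yD/q ≥ y` because
`(1−y)X ≥ y(D + 1 − q)` and `D ≤ q − y`; and `θ > y` gives `P{>j} ≥ θ` directly.
HONEST STATUS: partial (far-dominant layers); `SingleGateConvClosed`, `GateMove`, CW, `ConvClosedT`, `SDECConvClosed`, `TreeDEC`, `FarTreeRow` remain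
OPEN; the RATE class log\* and the honest sentence of `run/shared/lean/prim/quant/README.md` are unchanged.

* `LawDec.sum_datum` — `Σ_h c(h)·ν h = Σ_r λ_r (g_r c(hi_r) + (1−g_r) c(lo_r))` for a law given by a datum.
* **`LawDec.gateConv_tail_ge_farDominant`**, `LawDec.gateConv_decAt_farDominant_right`, **`LawDec.gateConv_decAt_farDominant`**.

[this work]; single-gate binder: prim-quant-lead g28 (this lane).  Nothing here is cited as a published result.  The gluing rows served
[cite: KozmaNitzan2024, Conjecture 3 (p. 15)]; product measure [cite: Grimmett1999, §1.3 p. 10].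
-/

noncomputable section

namespace Summit.CriticalPhenomena.PercolationContinuityZ3.Theorems

namespace Quant

open Finset

/-- the two-point law `{lo, hi; g}` (as in `…QuantLawDEC`) -/
local notation3 "TP[" lo ", " hi ", " g ", " h "]" =>
  (g : ℝ) * (if (h : ℕ) = (hi : ℕ) then (1 : ℝ) else 0) + (1 - (g : ℝ)) * (if (h : ℕ) = (lo : ℕ) then (1 : ℝ) else 0)

namespace LawDec

/-- **expectation over a datum**: if `ν h = Σ_r λ_r·TP_r(h)` with `lo_r ≤ hi_r ≤ M`, then for every `c : ℕ → ℝ`,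
`Σ_{h ≤ M} c h·ν h = Σ_r λ_r·(g_r·c(hi_r) + (1−g_r)·c(lo_r))`. [this work] -/
theorem sum_datum {ρ : Type} [Fintype ρ] (M : ℕ) (ν : ℕ → ℝ) (lam g : ρ → ℝ) (lo hi : ρ → ℕ) (c : ℕ → ℝ)
    (hlohi : ∀ r, lo r ≤ hi r) (hhi : ∀ r, hi r ≤ M) (hν : ∀ h, ν h = ∑ r, lam r * TP[lo r, hi r, g r, h]) :
    ∑ h ∈ Finset.range (M + 1), c h * ν h = ∑ r, lam r * (g r * c (hi r) + (1 - g r) * c (lo r)) := by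
  classical
  calc ∑ h ∈ Finset.range (M + 1), c h * ν h
      = ∑ h ∈ Finset.range (M + 1), ∑ r, lam r * (c h * TP[lo r, hi r, g r, h]) := by
        refine Finset.sum_congr rfl fun h _ => ?_
        rw [hν h, Finset.mul_sum]
        exact Finset.sum_congr rfl fun r _ => by ring
    _ = ∑ r, lam r * ∑ h ∈ Finset.range (M + 1), c h * TP[lo r, hi r, g r, h] := by
        rw [Finset.sum_comm]; exact Finset.sum_congr rfl fun r _ => by rw [Finset.mul_sum]
    _ = ∑ r, lam r * (g r * c (hi r) + (1 - g r) * c (lo r)) := by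
        refine Finset.sum_congr rfl fun r _ => ?_
        congr 1
        have e : ∀ h, c h * TP[lo r, hi r, g r, h]
            = g r * (if h = hi r then c (hi r) else 0) + (1 - g r) * (if h = lo r then c (lo r) else 0) := by
          intro h
          by_cases h1 : h = hi r
          · by_cases h2 : h = lo r
            · rw [if_pos h1, if_pos h2, if_pos h1, if_pos h2, ← h1, ← h2]; ring
            · rw [if_pos h1, if_neg h2, if_pos h1, if_neg h2, ← h1]; ring
          · by_cases h2 : h = lo r
            · rw [if_neg h1, if_pos h2, if_neg h1, if_pos h2, ← h2]; ring
            · rw [if_neg h1, if_neg h2, if_neg h1, if_neg h2]; ring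
        rw [Finset.sum_congr rfl (fun h _ => e h), Finset.sum_add_distrib, ← Finset.mul_sum, ← Finset.mul_sum,
          Finset.sum_ite_eq' (Finset.range (M + 1)) (hi r), if_pos (Finset.mem_range.2 (by have := hhi r; omega)),
          Finset.sum_ite_eq' (Finset.range (M + 1)) (lo r), if_pos (Finset.mem_range.2 (by have := (hlohi r).trans (hhi r); omega))]

/-- **THE GATED PER-COMPONENT BUDGET in the regime `4j < q(2T₂ + T₁)`.**  `ν₁ = gate μ₁ q` top-affordable and DEC at every layer
(`μ₁` a probability law on `{0..M₁}`, mean `T₁`), `0 < y < 1`, `y ≤ q ≤ 1`, `y·M₂ ≤ q·T₂`; a component `{lo ≤ hi ≤ M₂; g}` valid at `(y, qT₂, j)`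
(`ValidAt`, light credit pairs allowed); `Ψ(s) = Σ_i μ₁ i·[j+1 ≤ i+s]` the bare tails, `θ = ν₁{> j}`.  Then there is a split of the component's
weight `up + v + a = 1` (`up` = its mass above `j`) and a debt `0 ≤ d ≤ a` with `v + d ≤` its deep mass, `d ≤` its nonzero deep mass, and
`g·Ψ(hi) + (1−g)·Ψ(lo) ≥ y + ((1−y)up − y·v + ((1−q)y/q)·a) + v·θ/q − (y/q)·d`.  (Points/pairs above `j`: `up = 1`; self-sufficient points and
non-deep giant-pair lows: `a`; deep giant-pair lows: `v`; credit pairs: `a = 1` with `d = 0` if heavy, `d =` the deep mass if light — a light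
credit pair has `lo ≥ 1` by top-affordability.) [this work] -/
theorem gated_piece_budget (y q T₁ T₂ : ℝ) (j M₁ M₂ lo hi : ℕ) (g : ℝ) (μ₁ : ℕ → ℝ)
    (hy0 : 0 < y) (hy1 : y < 1) (hyq : y ≤ q) (hq1 : q ≤ 1)
    (h10 : ∀ h, 0 ≤ μ₁ h) (h1M : ∀ h, M₁ < h → μ₁ h = 0) (h11 : ∑ h ∈ Finset.range (M₁ + 1), μ₁ h = 1)
    (hT₁ : ∑ h ∈ Finset.range (M₁ + 1), (h : ℝ) * μ₁ h = T₁) (hta1 : y * (M₁ : ℝ) ≤ q * T₁)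
    (hdec1 : ∀ j', j' < M₁ → DECAt y j' M₁ (gate μ₁ q)) (hta2 : y * (M₂ : ℝ) ≤ q * T₂)
    (hg : 0 ≤ g ∧ g ≤ 1) (hlohi : lo ≤ hi) (hhi : hi ≤ M₂) (hval : ValidAt y (q * T₂) j lo hi g)
    (hdom : 4 * (j : ℝ) < q * (2 * T₂ + T₁)) :
    ∃ v a d : ℝ, 0 ≤ v ∧ 0 ≤ a ∧ 0 ≤ d ∧ d ≤ a ∧
      (g * (if j + 1 ≤ hi then (1 : ℝ) else 0) + (1 - g) * (if j + 1 ≤ lo then (1 : ℝ) else 0)) + v + a = 1 ∧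
      v + d ≤ g * (if hi ≤ j ∧ (hi : ℝ) + j < q * T₂ then (1 : ℝ) else 0)
        + (1 - g) * (if lo ≤ j ∧ (lo : ℝ) + j < q * T₂ then (1 : ℝ) else 0) ∧
      d ≤ g * (if (hi ≤ j ∧ (hi : ℝ) + j < q * T₂) ∧ 1 ≤ hi then (1 : ℝ) else 0)
        + (1 - g) * (if (lo ≤ j ∧ (lo : ℝ) + j < q * T₂) ∧ 1 ≤ lo then (1 : ℝ) else 0) ∧
      y + ((1 - y) * (g * (if j + 1 ≤ hi then (1 : ℝ) else 0) + (1 - g) * (if j + 1 ≤ lo then (1 : ℝ) else 0)) - y * v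
          + (1 - q) * y / q * a) + v * (∑ i ∈ Finset.range (M₁ + 1), (if j + 1 ≤ i then gate μ₁ q i else 0)) / q - y / q * d
        ≤ g * (∑ i ∈ Finset.range (M₁ + 1), μ₁ i * (if j + 1 ≤ i + hi then (1 : ℝ) else 0))
          + (1 - g) * (∑ i ∈ Finset.range (M₁ + 1), μ₁ i * (if j + 1 ≤ i + lo then (1 : ℝ) else 0)) := by
  classical
  have hq0 : 0 < q := hy0.trans_le hyq
  obtain ⟨hν10, hν1M, hν11⟩ := gate_laws M₁ μ₁ q hq0.le hq1 h10 h1M h11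
  have hν1T : ∑ h ∈ Finset.range (M₁ + 1), (h : ℝ) * gate μ₁ q h = q * T₁ := by rw [sum_mul_gate, hT₁]
  have hT1pos : 0 ≤ T₁ := by rw [← hT₁]; exact Finset.sum_nonneg fun h _ => mul_nonneg (Nat.cast_nonneg h) (h10 h)
  have hdom2 : 2 * (j : ℝ) < q * (T₁ + T₂) := by nlinarith
  set Ψ : ℕ → ℝ := fun s => ∑ i ∈ Finset.range (M₁ + 1), μ₁ i * (if j + 1 ≤ i + s then (1 : ℝ) else 0) with hΨ
  set θ : ℝ := ∑ i ∈ Finset.range (M₁ + 1), (if j + 1 ≤ i then gate μ₁ q i else 0) with hθ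
  have hΨ0 : ∀ s, 0 ≤ Ψ s := fun s => Finset.sum_nonneg fun i _ => mul_nonneg (h10 i) (by split_ifs <;> norm_num)
  have hΨ1 : ∀ s, j + 1 ≤ s → Ψ s = 1 := by
    intro s hs
    show ∑ i ∈ Finset.range (M₁ + 1), μ₁ i * (if j + 1 ≤ i + s then (1 : ℝ) else 0) = 1
    have e : ∀ i ∈ Finset.range (M₁ + 1), μ₁ i * (if j + 1 ≤ i + s then (1 : ℝ) else 0) = μ₁ i :=
      fun i _ => by rw [if_pos (by omega), mul_one]
    rw [Finset.sum_congr rfl e, h11]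
  -- the gated tails `q·Ψ(s)` for `s ≤ j`
  have hΨgate : ∀ s, s ≤ j → q * Ψ s = ∑ i ∈ Finset.range (M₁ + 1), gate μ₁ q i * (if j + 1 ≤ i + s then (1 : ℝ) else 0) := by
    intro s hs
    show q * ∑ i ∈ Finset.range (M₁ + 1), μ₁ i * (if j + 1 ≤ i + s then (1 : ℝ) else 0)
      = ∑ i ∈ Finset.range (M₁ + 1), gate μ₁ q i * (if j + 1 ≤ i + s then (1 : ℝ) else 0)
    rw [Finset.mul_sum]
    refine Finset.sum_congr rfl fun i _ => ?_
    by_cases h1 : j + 1 ≤ i + s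
    · rw [if_pos h1, gate_apply, if_neg (by omega)]; ring
    · rw [if_neg h1]; ring
  have hΨνtail : ∀ s, s ≤ j → ∑ i ∈ Finset.range (M₁ + 1), gate μ₁ q i * (if j + 1 ≤ i + s then (1 : ℝ) else 0)
      = ∑ i ∈ Finset.range (M₁ + 1), (if (j - s) + 1 ≤ i then gate μ₁ q i else 0) := by
    intro s hs
    refine Finset.sum_congr rfl fun i _ => ?_
    by_cases h1 : j + 1 ≤ i + s
    · rw [if_pos h1, if_pos (by omega), mul_one]
    · rw [if_neg h1, if_neg (by omega), mul_zero]
  have hθΨ : q * Ψ 0 = θ := by rw [hΨgate 0 (Nat.zero_le j), hΨνtail 0 (Nat.zero_le j), Nat.sub_zero]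
  have hθ0 : 0 ≤ θ := Finset.sum_nonneg fun i _ => by split_ifs; exacts [hν10 i, le_rfl]
  have hΨθ : ∀ s, s ≤ j → θ ≤ q * Ψ s := by
    intro s hs
    rw [hΨgate s hs, hΨνtail s hs, hθ]
    exact sum_gt_antitone M₁ j (j - s) (gate μ₁ q) hν10 (Nat.sub_le j s)
  have hΨrow : ∀ s, s ≤ j → 2 * ((j : ℝ) - s) < q * T₁ → y ≤ q * Ψ s := by
    intro s hs hd
    rw [hΨgate s hs, hΨνtail s hs]
    refine tail_ge_of_decAt_all y (q * T₁) M₁ (j - s) (gate μ₁ q) hy0 hy1 hν10 hν1M hν11 hν1T hta1 hdec1 ?_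
    rw [Nat.cast_sub hs]; exact hd
  have hyq' : (1 - q) * y / q = y / q - y := by field_simp
  have hyqy : y ≤ y / q := by rw [le_div_iff₀ hq0]; nlinarith
  have hyq1 : y / q ≤ 1 := by rw [div_le_one hq0]; exact hyq
  set up : ℝ := g * (if j + 1 ≤ hi then (1 : ℝ) else 0) + (1 - g) * (if j + 1 ≤ lo then (1 : ℝ) else 0) with hup
  set deep : ℝ := g * (if hi ≤ j ∧ (hi : ℝ) + j < q * T₂ then (1 : ℝ) else 0)
    + (1 - g) * (if lo ≤ j ∧ (lo : ℝ) + j < q * T₂ then (1 : ℝ) else 0) with hdeep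
  set deepnz : ℝ := g * (if (hi ≤ j ∧ (hi : ℝ) + j < q * T₂) ∧ 1 ≤ hi then (1 : ℝ) else 0)
    + (1 - g) * (if (lo ≤ j ∧ (lo : ℝ) + j < q * T₂) ∧ 1 ≤ lo then (1 : ℝ) else 0) with hdeepnz
  show ∃ v a d : ℝ, 0 ≤ v ∧ 0 ≤ a ∧ 0 ≤ d ∧ d ≤ a ∧ up + v + a = 1 ∧ v + d ≤ deep ∧ d ≤ deepnz ∧
      y + ((1 - y) * up - y * v + (1 - q) * y / q * a) + v * θ / q - y / q * d ≤ g * Ψ hi + (1 - g) * Ψ lo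
  have hg0 := hg.1; have hg1 := hg.2
  have hdeep0 : 0 ≤ deep := by
    simp only [hdeep]
    exact add_nonneg (mul_nonneg hg0 (by split_ifs <;> norm_num)) (mul_nonneg (by linarith) (by split_ifs <;> norm_num))
  have hdeepnz0 : 0 ≤ deepnz := by
    simp only [hdeepnz]
    exact add_nonneg (mul_nonneg hg0 (by split_ifs <;> norm_num)) (mul_nonneg (by linarith) (by split_ifs <;> norm_num))
  rcases hval with ⟨heq, hS⟩ | ⟨hlt, hgi, hyg⟩ | ⟨hlt, hhij, hcr⟩
  · -- (S) a point `b = lo = hi`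
    have eW : g * Ψ (hi) + (1 - g) * Ψ (lo) = Ψ (lo) := by rw [← heq]; ring
    by_cases hbj : j + 1 ≤ lo
    · -- above `j`: `up = 1`
      have eup : up = 1 := by simp only [hup]; rw [← heq, if_pos hbj]; ring
      refine ⟨0, 0, 0, le_rfl, le_rfl, le_rfl, le_rfl, by rw [eup]; ring, by rw [add_zero]; exact hdeep0, hdeepnz0, ?_⟩
      rw [eW, hΨ1 _ hbj, eup]; ring_nf; linarith
    · have hbj' : lo ≤ j := by omega
      have h2b : q * T₂ ≤ 2 * (lo : ℝ) := by
        rcases hS with h | h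
        · exact h
        · exact absurd h hbj
      have eup : up = 0 := by simp only [hup]; rw [← heq, if_neg hbj]; ring
      refine ⟨0, 1, 0, le_rfl, zero_le_one, le_rfl, zero_le_one, by rw [eup]; ring, by rw [add_zero]; exact hdeep0, hdeepnz0, ?_⟩
      rw [eW, eup]
      have hrow := hΨrow (lo) hbj' (by linarith)
      have hq' : y / q ≤ Ψ (lo) := by rw [div_le_iff₀ hq0]; linarith
      rw [hyq'] at *
      have : y + ((1 - y) * 0 - y * 0 + (y / q - y) * 1) + 0 * θ / q - y / q * 0 = y / q := by ring
      linarith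
  · -- (G) a giant pair `lo < hi`, `hi ≥ j+1`, `g ≥ y`
    rw [hΨ1 _ hgi, mul_one]
    by_cases hloj : j + 1 ≤ lo
    · have eup : up = 1 := by simp only [hup]; rw [if_pos hgi, if_pos hloj]; ring
      refine ⟨0, 0, 0, le_rfl, le_rfl, le_rfl, le_rfl, by rw [eup]; ring, by rw [add_zero]; exact hdeep0, hdeepnz0, ?_⟩
      rw [hΨ1 _ hloj, eup]; ring_nf; linarith
    · have hloj' : lo ≤ j := by omega
      have eup : up = g := by simp only [hup]; rw [if_pos hgi, if_neg hloj]; ring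
      by_cases hdl : (lo : ℝ) + j < q * T₂
      · -- deep low: `v = 1 − g`, value `g + (1−g)Ψ(lo) ≥ g + (1−g)θ/q`
        have edeep : (1 - g) ≤ deep := by
          simp only [hdeep]; rw [if_pos (show lo ≤ j ∧ (lo : ℝ) + j < q * T₂ from ⟨hloj', hdl⟩)]
          have : 0 ≤ g * (if hi ≤ j ∧ (hi : ℝ) + j < q * T₂ then (1 : ℝ) else 0) :=
            mul_nonneg hg0 (by split_ifs <;> norm_num)
          linarith
        refine ⟨1 - g, 0, 0, by linarith, le_rfl, le_rfl, le_rfl, by rw [eup]; ring, by linarith, hdeepnz0, ?_⟩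
        rw [eup]
        have hm := hΨθ (lo) hloj'
        have hq' : θ / q ≤ Ψ (lo) := by rw [div_le_iff₀ hq0]; linarith
        have h3 : 0 ≤ (1 - g) * (Ψ (lo) - θ / q) := mul_nonneg (by linarith) (by linarith)
        have e : g + (1 - g) * Ψ (lo)
            - (y + ((1 - y) * g - y * (1 - g) + (1 - q) * y / q * 0) + (1 - g) * θ / q - y / q * 0)
            = (1 - g) * (Ψ (lo) - θ / q) := by ring
        linarith
      · -- non-deep low: the regime makes `j − lo` dominant for `ν₁`: `Ψ(lo) ≥ y/q`
        refine ⟨0, 1 - g, 0, le_rfl, by linarith, le_rfl, by linarith, by rw [eup]; ring, by rw [add_zero]; exact hdeep0,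
          hdeepnz0, ?_⟩
        rw [eup]
        have hrow := hΨrow (lo) hloj' (by linarith [not_lt.1 hdl])
        have hq' : y / q ≤ Ψ (lo) := by rw [div_le_iff₀ hq0]; linarith
        have h3 : 0 ≤ (1 - g) * (Ψ (lo) - y / q) := mul_nonneg (by linarith) (by linarith)
        rw [hyq']
        have e : g + (1 - g) * Ψ (lo)
            - (y + ((1 - y) * g - y * 0 + (y / q - y) * (1 - g)) + 0 * θ / q - y / q * 0)
            = (1 - g) * (Ψ (lo) - y / q) := by ring
        linarith
  · -- (N) a credit pair `lo < hi ≤ j` (heavy or light): `piece_budget` on `ν₁`, divided by `q`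
    have hloj : lo ≤ j := hlt.le.trans hhij
    have eup : up = 0 := by simp only [hup]; rw [if_neg (by omega), if_neg (by omega)]; ring
    have hpb := piece_budget y (q * T₁) (q * T₂) j M₁ (lo) (hi) (g) (gate μ₁ q) hy0 hy1 hν10 hν1M hν11 hν1T hta1 hdec1
      (hg) (hlohi) (Or.inr (Or.inr ⟨hlt, hhij, hcr⟩)) (by linarith)
    rw [if_neg (by omega : ¬ j + 1 ≤ hi), if_neg (by omega : ¬ j + 1 ≤ lo)] at hpb
    -- `hpb : (1−y)·0 − y·dl ≤ g Ψν(hi) + (1−g) Ψν(lo) − y` with `dl` = the deep mass (lo part first)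
    rw [← hΨgate (hi) hhij, ← hΨgate (lo) hloj] at hpb
    by_cases hyg : y ≤ g
    · -- heavy: worth `≥ y/q`, no debt
      have hcrH : q * T₂ ≤ 2 * (lo : ℝ) + ((hi : ℝ) - lo) * g := by rw [if_pos hyg] at hcr; exact hcr
      set τ : ℝ := ∑ i ∈ Finset.range (M₁ + 1), (if (j - lo) + 1 ≤ i then gate μ₁ q i else 0) with hτ
      set u : ℝ := ∑ i ∈ Finset.range (M₁ + 1), (if i ≤ j - hi then gate μ₁ q i else 0) with hu
      have ea : q * Ψ (lo) = τ := by rw [hΨgate _ hloj, hΨνtail _ hloj]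
      have eb : q * Ψ (hi) = 1 - u := by
        rw [hΨgate _ hhij, hΨνtail _ hhij]
        have hs := sum_le_add_sum_gt M₁ (j - hi) (gate μ₁ q)
        rw [hν11] at hs; linarith
      have hii : j - hi ≤ j - lo := by omega
      have hdp : ((j - lo : ℕ) : ℝ) + ((j - hi : ℕ) : ℝ) < q * T₁ := by
        rw [Nat.cast_sub hloj, Nat.cast_sub hhij]
        have hd : (0 : ℝ) ≤ (hi : ℝ) - lo := by
          have : (lo : ℝ) ≤ hi := by exact_mod_cast hlt.le
          linarith
        have hm := mul_le_mul_of_nonneg_left hg1 hd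
        linarith
      have hgb := deepLows_le_giants y (q * T₁) M₁ (j - lo) (j - hi) (gate μ₁ q) hy0 hy1 hν10 hν1M hν11 hν1T hta1 hdec1 hii hdp
      have hτu : τ ≤ 1 - u := by
        have hmono := sum_gt_antitone M₁ (j - lo) (j - hi) (gate μ₁ q) hν10 hii
        have hs := sum_le_add_sum_gt M₁ (j - hi) (gate μ₁ q)
        rw [hν11] at hs; rw [hτ, hu]; linarith
      rw [← hτ, ← hu] at hgb
      refine ⟨0, 1, 0, le_rfl, zero_le_one, le_rfl, zero_le_one, by rw [eup]; ring, by rw [add_zero]; exact hdeep0, hdeepnz0, ?_⟩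
      rw [eup, hyq']
      have h1 : y * (1 - u - τ) ≤ g * (1 - u - τ) := mul_le_mul_of_nonneg_right hyg (by linarith)
      have hval' : y ≤ (1 - g) * τ + g * (1 - u) := by linarith
      have e2 : q * (g * Ψ (hi) + (1 - g) * Ψ (lo)) = g * (q * Ψ (hi)) + (1 - g) * (q * Ψ (lo)) := by ring
      have hW : y / q ≤ g * Ψ (hi) + (1 - g) * Ψ (lo) := by
        rw [div_le_iff₀ hq0]
        have e3 : (g * Ψ (hi) + (1 - g) * Ψ (lo)) * q = g * (1 - u) + (1 - g) * τ := by
          rw [mul_comm, e2, ea, eb]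
        rw [e3]; linarith
      have : y + ((1 - y) * 0 - y * 0 + (y / q - y) * 1) + 0 * θ / q - y / q * 0 = y / q := by ring
      linarith
    · -- light: `lo ≥ 1` (a light zero-component would have `hi > M₂`), debt `d = deep`
      have hgy : g < y := not_le.1 hyg
      have hcrL : q * T₂ ≤ 2 * (lo : ℝ) + ((hi : ℝ) - lo) * ((g - y ^ 2) / (1 - y)) := by
        rw [if_neg hyg] at hcr; exact hcr
      have hlo1 : 1 ≤ lo := by
        by_contra hc
        have hlo0 : lo = 0 := by omega
        rw [hlo0] at hcrL
        simp only [Nat.cast_zero, mul_zero, zero_add, sub_zero] at hcrL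
        have hκ : (g - y ^ 2) / (1 - y) ≤ y := by
          rw [div_le_iff₀ (by linarith)]
          have : y * (1 - y) = y - y ^ 2 := by ring
          linarith
        have hhiM : (hi : ℝ) ≤ M₂ := by exact_mod_cast hhi
        have hhi0 : (0 : ℝ) ≤ hi := Nat.cast_nonneg _
        have h1 : (hi : ℝ) * ((g - y ^ 2) / (1 - y)) ≤ (hi : ℝ) * y := mul_le_mul_of_nonneg_left hκ hhi0
        have h2 : (hi : ℝ) * y ≤ (M₂ : ℝ) * y := mul_le_mul_of_nonneg_right hhiM hy0.le
        -- `qT₂ ≤ hi·κ ≤ hi·y ≤ M₂·y ≤ qT₂`: all equalities, so `κ = y` on a charged... contradiction needs strictness: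
        -- strict: `κ < y` and `hi ≥ 1`
        have hκ' : (g - y ^ 2) / (1 - y) < y := by
          rw [div_lt_iff₀ (by linarith)]
          have : y * (1 - y) = y - y ^ 2 := by ring
          linarith
        have hhipos : (0 : ℝ) < hi := by
          have : (1 : ℕ) ≤ hi := by omega
          exact_mod_cast this
        have h1' : (hi : ℝ) * ((g - y ^ 2) / (1 - y)) < (hi : ℝ) * y := mul_lt_mul_of_pos_left hκ' hhipos
        linarith
      have hhi1 : 1 ≤ hi := by omega
      have edeepnz : deepnz = deep := by
        have f1 : (if (hi ≤ j ∧ (hi : ℝ) + j < q * T₂) ∧ 1 ≤ hi then (1 : ℝ) else 0)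
            = (if hi ≤ j ∧ (hi : ℝ) + j < q * T₂ then (1 : ℝ) else 0) := by
          by_cases hP : hi ≤ j ∧ (hi : ℝ) + j < q * T₂
          · rw [if_pos ⟨hP, hhi1⟩, if_pos hP]
          · rw [if_neg (fun h => hP h.1), if_neg hP]
        have f2 : (if (lo ≤ j ∧ (lo : ℝ) + j < q * T₂) ∧ 1 ≤ lo then (1 : ℝ) else 0)
            = (if lo ≤ j ∧ (lo : ℝ) + j < q * T₂ then (1 : ℝ) else 0) := by
          by_cases hP : lo ≤ j ∧ (lo : ℝ) + j < q * T₂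
          · rw [if_pos ⟨hP, hlo1⟩, if_pos hP]
          · rw [if_neg (fun h => hP h.1), if_neg hP]
        show g * (if (hi ≤ j ∧ (hi : ℝ) + j < q * T₂) ∧ 1 ≤ hi then (1 : ℝ) else 0)
            + (1 - g) * (if (lo ≤ j ∧ (lo : ℝ) + j < q * T₂) ∧ 1 ≤ lo then (1 : ℝ) else 0)
          = g * (if hi ≤ j ∧ (hi : ℝ) + j < q * T₂ then (1 : ℝ) else 0)
            + (1 - g) * (if lo ≤ j ∧ (lo : ℝ) + j < q * T₂ then (1 : ℝ) else 0)
        rw [f1, f2]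
      have hdeep1 : deep ≤ 1 := by
        have i1 : (if hi ≤ j ∧ (hi : ℝ) + j < q * T₂ then (1 : ℝ) else 0) ≤ 1 := by split_ifs <;> norm_num
        have i2 : (if lo ≤ j ∧ (lo : ℝ) + j < q * T₂ then (1 : ℝ) else 0) ≤ 1 := by split_ifs <;> norm_num
        have j1 := mul_le_mul_of_nonneg_left i1 hg0
        have j2 := mul_le_mul_of_nonneg_left i2 (show 0 ≤ 1 - g by linarith)
        show g * (if hi ≤ j ∧ (hi : ℝ) + j < q * T₂ then (1 : ℝ) else 0)
            + (1 - g) * (if lo ≤ j ∧ (lo : ℝ) + j < q * T₂ then (1 : ℝ) else 0) ≤ 1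
        linarith
      refine ⟨0, 1, deep, le_rfl, zero_le_one, hdeep0, hdeep1, by rw [eup]; ring, by rw [zero_add], by rw [edeepnz], ?_⟩
      rw [eup, hyq']
      -- `hpb : 0 − y·(deep, lo-first order) ≤ g·(qΨ hi) + (1−g)·(qΨ lo) − y`; reorder `deep`
      have edl : (1 - g) * (if lo ≤ j ∧ (lo : ℝ) + j < q * T₂ then (1 : ℝ) else 0)
          + g * (if hi ≤ j ∧ (hi : ℝ) + j < q * T₂ then (1 : ℝ) else 0) = deep := by simp only [hdeep]; ring
      rw [edl] at hpb
      have e2 : g * (q * Ψ (hi)) + (1 - g) * (q * Ψ (lo)) = q * (g * Ψ (hi) + (1 - g) * Ψ (lo)) := by ring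
      rw [e2] at hpb
      -- `y − y·deep ≤ q·W` ⇒ `y/q − (y/q)·deep ≤ W`
      have hW : y / q - y / q * deep ≤ g * Ψ (hi) + (1 - g) * Ψ (lo) := by
        have : y - y * deep ≤ q * (g * Ψ (hi) + (1 - g) * Ψ (lo)) := by linarith
        have e3 : y / q - y / q * deep = (y - y * deep) / q := by ring
        rw [e3, div_le_iff₀ hq0]; linarith
      have : y + ((1 - y) * 0 - y * 0 + (y / q - y) * 1) + 0 * θ / q - y / q * deep = y / q - y / q * deep := by ring
      linarith

end LawDec

end Quant

end Summit.CriticalPhenomena.PercolationContinuityZ3.Theorems
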